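import Literature.Probability.LatticeModels.ObservableBulkGeometry
import Literature.Probability.LatticeModels.HoleFreePotential
import Literature.Probability.RandomPlanarGeometry.ExteriorULC
import HarnessLib

/-!
# The exterior lattice component of a Jordan domain: hole-freeness and presence near the boundary

Topic `Literature/Probability/LatticeModels`; an instalment (items P5/B3 of the road recorded in
`Sweep1Proofs.lean`, module docstring §2b) of the discharge programme for crit-ising.S18 /
Smirnov's Theorem 2.2. The weak Beurling estimate (`WeakBeurling.lean`) is applied inside a
hole-free set `K` of sites/faces containing the region where the FK primitive is sub/superharmonic,
together with a point `F₀ ∉ K` near the boundary point under consideration. This file provides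
that geometry for the discretisations `δℤ²` of a Jordan domain `D`: the **exterior lattice
component** `ExtConn D δ` (sites whose mesh points lie off `closure D`, joined through such sites
to sites of arbitrarily large height); its complement is hole-free by construction
(`holeFree_compl_extConn`), contains every site with mesh point in `D` (`not_mem_extConn_of_mem`),
and — the one place where the Jordan curve theorem enters, through `ExteriorULC.lean`
(`frontier_subset_closure_exterior'`, `isConnected_exterior`) — for every boundary point `p` and
`ρ > 0`, for all small meshes some site of `ExtConn D δ` has its mesh point within `ρ` of `p`
(`eventually_exists_extConn_near`: follow a path in the open connected exterior from near `p` to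
far above `D` by the lattice). Everything is proved.

* `ExtStep`, `ExtConn`, `reflTransGen_extStep_symm`, `mem_extConn_of_reflTransGen`,
  `holeFree_compl_extConn`, `not_mem_extConn_of_mem`, `reflTransGen_extStep_line`,
  `reflTransGen_extStep_of_supNear`, `abs_sub_mul_le_dist_meshPoint'`, `not_mem_closure_of_near`,
  **`eventually_exists_extConn_near`**.

## References

* S. Smirnov, Ann. of Math. 172 (2010) 1435–1467, App. B (simply connected lattice domains) — bib
  key `Smirnov2010`.
-/

noncomputable section

namespace Literature.Probability.LatticeModels

open Set Metric Filter _root_.Topology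

/-! ### The exterior lattice component and its hole-free complement -/

/-- Steps of `ℤ²` between sites whose mesh points lie off `closure Ω`. [folklore] -/
def ExtStep (Ω : Set ℂ) (δ : ℝ) (a b : Site 2) : Prop :=
  (zdGraph 2).Adj a b ∧ meshPoint δ a ∉ closure Ω ∧ meshPoint δ b ∉ closure Ω

/-- **The exterior lattice component**: sites off `closure Ω` joined through such sites to sites of
arbitrarily large height. [folklore] -/
def ExtConn (Ω : Set ℂ) (δ : ℝ) : Set (Site 2) :=
  {y | meshPoint δ y ∉ closure Ω ∧ ∀ M : ℤ, ∃ y', M ≤ y' 1 ∧ Relation.ReflTransGen (ExtStep Ω δ) y y'}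

/-- `ExtStep` is symmetric. [folklore] -/
theorem ExtStep.symm {Ω : Set ℂ} {δ : ℝ} {a b : Site 2} (h : ExtStep Ω δ a b) : ExtStep Ω δ b a :=
  ⟨h.1.symm, h.2.2, h.2.1⟩

/-- Reversal of exterior chains. [folklore] -/
theorem reflTransGen_extStep_symm {Ω : Set ℂ} {δ : ℝ} {a b : Site 2} (h : Relation.ReflTransGen (ExtStep Ω δ) a b) :
    Relation.ReflTransGen (ExtStep Ω δ) b a := by
  induction h with
  | refl => exact Relation.ReflTransGen.refl
  | tail _ hbc ih => exact (Relation.ReflTransGen.single hbc.symm).trans ih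

/-- Points reached by exterior steps from a point of the exterior component lie in it. [folklore] -/
theorem mem_extConn_of_reflTransGen {Ω : Set ℂ} {δ : ℝ} {y z : Site 2} (hy : y ∈ ExtConn Ω δ)
    (h : Relation.ReflTransGen (ExtStep Ω δ) y z) : z ∈ ExtConn Ω δ := by
  induction h with
  | refl => exact hy
  | @tail b c _ hbc ih =>
    refine ⟨hbc.2.2, fun M => ?_⟩
    obtain ⟨y', hy', hpath⟩ := ih.2 M
    exact ⟨y', hy', (Relation.ReflTransGen.single hbc.symm).trans hpath⟩

/-- **The complement of the exterior component is hole-free.** [folklore] -/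
theorem holeFree_compl_extConn (Ω : Set ℂ) (δ : ℝ) : HoleFree (ExtConn Ω δ)ᶜ := by
  intro g hg M
  rw [Set.mem_compl_iff, not_not] at hg
  obtain ⟨g', hg', hpath⟩ := hg.2 M
  refine ⟨g', hg', ?_⟩
  clear hg'
  induction hpath with
  | refl => exact Relation.ReflTransGen.refl
  | @tail b c hab hbc ih =>
    refine ih.tail ⟨hbc.1, ?_, ?_⟩
    · rw [Set.mem_compl_iff, not_not]; exact mem_extConn_of_reflTransGen hg hab
    · rw [Set.mem_compl_iff, not_not]; exact mem_extConn_of_reflTransGen hg (hab.tail hbc)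

/-- Sites with mesh point in `Ω` are not in the exterior component. [folklore] -/
theorem not_mem_extConn_of_mem {Ω : Set ℂ} {δ : ℝ} {y : Site 2} (hy : meshPoint δ y ∈ Ω) : y ∉ ExtConn Ω δ :=
  fun h => h.1 (subset_closure hy)

/-! ### Straight exterior chains -/

/-- A straight run of `t` steps in direction `k` all of whose sites are exterior is an exterior
chain. [folklore] -/
theorem reflTransGen_extStep_line {Ω : Set ℂ} {δ : ℝ} (x : Site 2) (k : Fin 4) (t : ℕ)
    (h : ∀ s : ℕ, s ≤ t → meshPoint δ (x + (s : ℤ) • cornerUnit k) ∉ closure Ω) :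
    Relation.ReflTransGen (ExtStep Ω δ) x (x + (t : ℤ) • cornerUnit k) := by
  induction t with
  | zero => simpa using Relation.ReflTransGen.refl
  | succ t ih =>
    have h' := ih fun s hs => h s (Nat.le_succ_of_le hs)
    refine h'.tail ⟨?_, h t (Nat.le_succ t), by exact_mod_cast h (t + 1) le_rfl⟩
    rw [show ((t + 1 : ℕ) : ℤ) • cornerUnit k = (t : ℤ) • cornerUnit k + cornerUnit k by push_cast; rw [add_zsmul, one_zsmul],
      ← add_assoc, zdGraph_adj_iff]
    fin_cases k
    · exact ⟨0, Or.inl rfl⟩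
    · exact ⟨1, Or.inl rfl⟩
    · exact ⟨0, Or.inr (by simp [cornerUnit])⟩
    · exact ⟨1, Or.inr (by simp [cornerUnit])⟩

/-- **Two nearby sites in a deeply exterior region are joined by an exterior chain**: if `x'` is
within sup-distance `n` of `x` and every site within sup-distance `n` of `x` is exterior, go along
the first axis then the second. [folklore] -/
theorem reflTransGen_extStep_of_supNear {Ω : Set ℂ} {δ : ℝ} {x x' : Site 2} {n : ℕ}
    (hx' : DiscreteDobrushin.supNear x n x')
    (h : ∀ z, DiscreteDobrushin.supNear x n z → meshPoint δ z ∉ closure Ω) :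
    Relation.ReflTransGen (ExtStep Ω δ) x x' := by
  have h0 := hx' 0
  have h1 := hx' 1
  have hab0 := le_abs_self (x' 0 - x 0); have hab0' := neg_abs_le (x' 0 - x 0)
  have hab1 := le_abs_self (x' 1 - x 1); have hab1' := neg_abs_le (x' 1 - x 1)
  set xm : Site 2 := ![x' 0, x 1] with hxm
  -- first leg
  have leg1 : Relation.ReflTransGen (ExtStep Ω δ) x xm := by
    rcases le_or_gt 0 (x' 0 - x 0) with hpos | hneg
    · set t := (x' 0 - x 0).toNat
      have htz : (t : ℤ) = x' 0 - x 0 := Int.toNat_of_nonneg hpos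
      have e : xm = x + (t : ℤ) • cornerUnit 0 := by ext i; fin_cases i <;> simp [hxm, cornerUnit, htz]
      rw [e]
      exact reflTransGen_extStep_line x 0 t fun s hs => h _ (fun i => by fin_cases i <;> simp [cornerUnit]; omega)
    · set t := (x 0 - x' 0).toNat
      have htz : (t : ℤ) = x 0 - x' 0 := Int.toNat_of_nonneg (by omega)
      have e : xm = x + (t : ℤ) • cornerUnit 2 := by ext i; fin_cases i <;> simp [hxm, cornerUnit, htz]
      rw [e]
      exact reflTransGen_extStep_line x 2 t fun s hs => h _ (fun i => by fin_cases i <;> simp [cornerUnit]; omega)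
  -- second leg
  have leg2 : Relation.ReflTransGen (ExtStep Ω δ) xm x' := by
    rcases le_or_gt 0 (x' 1 - x 1) with hpos | hneg
    · set t := (x' 1 - x 1).toNat
      have htz : (t : ℤ) = x' 1 - x 1 := Int.toNat_of_nonneg hpos
      have e : x' = xm + (t : ℤ) • cornerUnit 1 := by ext i; fin_cases i <;> simp [hxm, cornerUnit, htz]
      rw [e]
      exact reflTransGen_extStep_line xm 1 t fun s hs => h _ (fun i => by fin_cases i <;> simp [hxm, cornerUnit] <;> omega)
    · set t := (x 1 - x' 1).toNat
      have htz : (t : ℤ) = x 1 - x' 1 := Int.toNat_of_nonneg (by omega)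
      have e : x' = xm + (t : ℤ) • cornerUnit 3 := by ext i; fin_cases i <;> simp [hxm, cornerUnit, htz]
      rw [e]
      exact reflTransGen_extStep_line xm 3 t fun s hs => h _ (fun i => by fin_cases i <;> simp [hxm, cornerUnit] <;> omega)
  exact leg1.trans leg2

/-! ### The exterior component comes close to every boundary point -/

/-- Mesh distances dominate coordinate differences. [folklore] -/
theorem abs_sub_mul_le_dist_meshPoint' (δ : ℝ) (x y : Site 2) (i : Fin 2) :
    |δ| * |((y i : ℤ) : ℝ) - x i| ≤ dist (meshPoint δ y) (meshPoint δ x) := by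
  rw [Complex.dist_eq]
  fin_cases i
  · have := Complex.abs_re_le_norm (meshPoint δ y - meshPoint δ x)
    simp only [Complex.sub_re, meshPoint_re] at this
    rwa [← mul_sub, abs_mul] at this
  · have := Complex.abs_im_le_norm (meshPoint δ y - meshPoint δ x)
    simp only [Complex.sub_im, meshPoint_im] at this
    rwa [← mul_sub, abs_mul] at this

/-- Sites whose mesh points are within `ε` of a set `T` with `cthickening ε T` in the exterior are
exterior. [folklore] -/
theorem not_mem_closure_of_near {Ω T : Set ℂ} {ε : ℝ} (hT : cthickening ε T ⊆ (closure Ω)ᶜ) {z w : ℂ}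
    (hw : w ∈ T) (hz : dist z w ≤ ε) : z ∉ closure Ω :=
  hT (Metric.mem_cthickening_of_dist_le z w ε T hw hz)

/-- **The exterior lattice component near a boundary point.** For a Jordan domain `D`, a boundary
point `p` and `ρ > 0`: for all small `δ > 0` some site of the exterior lattice component
`ExtConn D δ` has its mesh point within `ρ` of `p` (exterior points accumulate at `p`, the
exterior is open, connected and unbounded, and a path in it from near `p` to far above `D` can be
followed by the lattice once the mesh is finer than its distance to `∂D`).
[cite: Smirnov2010, Lemma B.2 (simply connected lattice domains)] -/
theorem eventually_exists_extConn_near (D : RandomPlanarGeometry.JordanDomain) {p : ℂ} (hp : p ∈ frontier D.carrier)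
    {ρ : ℝ} (hρ : 0 < ρ) :
    ∀ᶠ δ in 𝓝[>] (0 : ℝ), ∃ y : Site 2, dist (meshPoint δ y) p < ρ ∧ y ∈ ExtConn D.carrier δ := by
  -- an exterior point `q` near `p`
  have hpcl : p ∈ closure (closure D.carrier)ᶜ := D.frontier_subset_closure_exterior' hp
  obtain ⟨q, hq, hpq⟩ := Metric.mem_closure_iff.1 hpcl (ρ / 2) (by positivity)
  -- a far exterior point `q'` straight above everything
  obtain ⟨R₀, hR₀⟩ := D.isBounded.subset_closedBall (0 : ℂ)
  have hclR : closure D.carrier ⊆ closedBall (0 : ℂ) (|R₀| + 1) :=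
    closure_minimal (hR₀.trans (closedBall_subset_closedBall (by linarith [le_abs_self R₀]))) isClosed_closedBall
  set q' : ℂ := (((|R₀| + 10 : ℝ)) : ℂ) * Complex.I with hq'
  have hq'ext : q' ∈ (closure D.carrier)ᶜ := by
    intro h
    have := hclR h
    rw [mem_closedBall, dist_zero_right, hq', norm_mul, Complex.norm_I, mul_one, Complex.norm_real, Real.norm_eq_abs,
      abs_of_pos (by positivity)] at this
    linarith
  -- a path in the exterior from `q` to `q'`
  have hpc : IsPathConnected (closure D.carrier)ᶜ := (D.isOpen_exterior.isConnected_iff_isPathConnected).1 D.isConnected_exterior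
  have hJ : JoinedIn (closure D.carrier)ᶜ q q' := hpc.joinedIn q hq q' hq'ext
  set γ := hJ.somePath with hγ
  have hγext : ∀ t, γ t ∈ (closure D.carrier)ᶜ := hJ.somePath_mem
  -- a margin `ε₀` around the path inside the exterior
  have hKc : IsCompact (range γ) := isCompact_range γ.continuous
  have hKsub : range γ ⊆ (closure D.carrier)ᶜ := by rintro _ ⟨t, rfl⟩; exact hγext t
  obtain ⟨ε₀, hε₀, hthick⟩ := hKc.exists_cthickening_subset_open D.isOpen_exterior hKsub
  -- small meshes
  have hsmall : ∀ᶠ δ in 𝓝[>] (0 : ℝ), δ < min (ε₀ / 8) (min (ρ / 2) 1) := nhdsWithin_le_nhds (Iio_mem_nhds (by positivity))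
  filter_upwards [hsmall, (self_mem_nhdsWithin : ∀ᶠ δ in 𝓝[>] (0 : ℝ), 0 < δ)] with δ hδs hδ0'
  have hδ0 : 0 < δ := hδ0'
  rw [lt_min_iff, lt_min_iff] at hδs
  obtain ⟨hδε, hδρ, hδ1⟩ := hδs
  -- uniform continuity of the path: steps of parameter `1/n` move by `< δ/2`
  have huc := CompactSpace.uniformContinuous_of_continuous γ.continuous
  obtain ⟨τ, hτ, hτuc⟩ := Metric.uniformContinuous_iff.1 huc (δ / 2) (by positivity)
  obtain ⟨n, hn⟩ := exists_nat_gt (1 / τ)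
  have hn0 : 0 < n := by
    have : (0 : ℝ) < n := lt_trans (by positivity) hn
    exact_mod_cast this
  have hnτ : 1 / (n : ℝ) < τ := by
    rw [div_lt_iff₀ (by exact_mod_cast hn0)]
    rw [div_lt_iff₀ hτ] at hn; linarith
  -- parameter points `t_i = i/n`
  have hti : ∀ i : ℕ, i ≤ n → (i : ℝ) / n ∈ unitInterval := fun i hi =>
    ⟨by positivity, by rw [div_le_one (by exact_mod_cast hn0)]; exact_mod_cast hi⟩
  set T : ℕ → unitInterval := fun i => if h : i ≤ n then ⟨(i : ℝ) / n, hti i h⟩ else 0 with hT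
  set X : ℕ → Site 2 := fun i => nearestSite δ (γ (T i)) with hX
  have hXdist : ∀ i, dist (meshPoint δ (X i)) (γ (T i)) ≤ δ := fun i => dist_meshPoint_nearestSite_le hδ0 _
  -- all sites within sup-distance `3` of some `X i` are exterior
  have hdeep : ∀ i (z : Site 2), DiscreteDobrushin.supNear (X i) 3 z → meshPoint δ z ∉ closure D.carrier := by
    intro i z hz
    refine not_mem_closure_of_near hthick ⟨T i, rfl⟩ ?_
    have h1 := DiscreteDobrushin.dist_meshPoint_le_of_supNear hδ0.le hz
    push_cast at h1
    calc dist (meshPoint δ z) (γ (T i)) ≤ dist (meshPoint δ z) (meshPoint δ (X i)) + dist (meshPoint δ (X i)) (γ (T i)) :=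
          dist_triangle _ _ _
      _ ≤ δ * (2 * 3) + δ := add_le_add h1 (hXdist i)
      _ ≤ ε₀ := by linarith
  -- consecutive sites are within sup-distance `3`
  have hstep : ∀ i, i < n → DiscreteDobrushin.supNear (X i) 3 (X (i + 1)) := by
    intro i hi
    have hpar : dist (T i) (T (i + 1)) < τ := by
      simp only [hT, dif_pos hi.le, dif_pos (Nat.succ_le_of_lt hi)]
      rw [Subtype.dist_eq, Real.dist_eq]
      push_cast
      rw [show (i : ℝ) / n - (i + 1) / n = -(1 / n) by ring, abs_neg, abs_of_pos (by positivity)]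
      exact hnτ
    have hγd : dist (γ (T i)) (γ (T (i + 1))) < δ / 2 := hτuc hpar
    have hmesh : dist (meshPoint δ (X (i + 1))) (meshPoint δ (X i)) ≤ δ * 3 := by
      calc dist (meshPoint δ (X (i + 1))) (meshPoint δ (X i))
          ≤ dist (meshPoint δ (X (i + 1))) (γ (T (i + 1))) + dist (γ (T (i + 1))) (γ (T i)) + dist (γ (T i)) (meshPoint δ (X i)) :=
            dist_triangle4 _ _ _ _
        _ ≤ δ + δ / 2 + δ := by
            gcongr
            · exact hXdist (i + 1)
            · rw [dist_comm]; exact hγd.le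
            · rw [dist_comm]; exact hXdist i
        _ ≤ δ * 3 := by linarith
    intro j
    have hc := abs_sub_mul_le_dist_meshPoint' δ (X i) (X (i + 1)) j
    rw [abs_of_pos hδ0] at hc
    have : |((X (i + 1) j - X i j : ℤ) : ℝ)| ≤ 3 := by
      have h3 : δ * |((X (i + 1) j : ℤ) : ℝ) - X i j| ≤ δ * 3 := hc.trans hmesh
      have := le_of_mul_le_mul_left h3 hδ0
      push_cast; exact this
    have : |X (i + 1) j - X i j| ≤ 3 := by exact_mod_cast this
    exact this
  -- the chain from `X 0` to `X i`
  have hchain : ∀ i, i ≤ n → Relation.ReflTransGen (ExtStep D.carrier δ) (X 0) (X i) := by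
    intro i hi
    induction i with
    | zero => exact Relation.ReflTransGen.refl
    | succ i ih =>
      exact (ih (Nat.le_of_succ_le hi)).trans (reflTransGen_extStep_of_supNear (hstep i (Nat.lt_of_succ_le hi)) (hdeep i))
  -- from `X n` straight up forever
  have hXn : meshPoint δ (X n) ∈ closedBall q' δ := by
    have : T n = ⟨1, by simp⟩ := by simp only [hT, dif_pos le_rfl]; congr 1; rw [div_self]; exact_mod_cast hn0.ne'
    have h1 : γ (T n) = q' := by rw [this]; exact γ.target
    rw [mem_closedBall, ← h1]; exact hXdist n
  have hup : ∀ s : ℕ, meshPoint δ (X n + (s : ℤ) • cornerUnit 1) ∉ closure D.carrier := by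
    intro s h
    have hball := hclR h
    rw [mem_closedBall, dist_zero_right] at hball
    rw [mem_closedBall, Complex.dist_eq] at hXn
    -- the imaginary part grows: `Im (mesh) = Im (mesh X n) + s δ ≥ |R₀| + 10 - δ + 0`
    have him : (meshPoint δ (X n + (s : ℤ) • cornerUnit 1)).im = (meshPoint δ (X n)).im + δ * s := by
      simp [meshPoint_im, cornerUnit]; ring
    have h2 : |(meshPoint δ (X n) - q').im| ≤ δ := (Complex.abs_im_le_norm _).trans hXn
    rw [Complex.sub_im] at h2
    have hq'im : q'.im = |R₀| + 10 := by simp [hq']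
    rw [hq'im, abs_le] at h2
    have h3 : (meshPoint δ (X n + (s : ℤ) • cornerUnit 1)).im ≤ ‖meshPoint δ (X n + (s : ℤ) • cornerUnit 1)‖ :=
      (le_abs_self _).trans (Complex.abs_im_le_norm _)
    have hs0 : (0 : ℝ) ≤ δ * s := by positivity
    linarith [h2.1, h2.2]
  -- conclusion: `X 0` works
  refine ⟨X 0, ?_, hdeep 0 _ (DiscreteDobrushin.supNear_self _ (by norm_num)), fun M => ?_⟩
  · have hT0 : γ (T 0) = q := by
      have : T 0 = ⟨0, by simp⟩ := by simp only [hT, dif_pos (Nat.zero_le n)]; congr 1; simp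
      rw [this]; exact γ.source
    calc dist (meshPoint δ (X 0)) p ≤ dist (meshPoint δ (X 0)) (γ (T 0)) + dist (γ (T 0)) p := dist_triangle _ _ _
      _ < δ + ρ / 2 := by
          refine add_lt_add_of_le_of_lt (hXdist 0) ?_
          rw [hT0, dist_comm]; exact hpq
      _ < ρ := by linarith
  · -- go to `X n`, then up by `t` steps with `t ≥ M - (X n) 1`
    set t : ℕ := (M - (X n) 1).toNat with ht
    refine ⟨X n + (t : ℤ) • cornerUnit 1, ?_, (hchain n le_rfl).trans (reflTransGen_extStep_line (X n) 1 t fun s _ => hup s)⟩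
    have : M - (X n) 1 ≤ (t : ℤ) := Int.self_le_toNat _
    simp [cornerUnit]; omega

end Literature.Probability.LatticeModels
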